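import Literature.AnabelianGeometry.AbsoluteAnabelian.ProfiniteIndexTwoInversionSlim
import Literature.AnabelianGeometry.SemiGraphs.ProSigmaCompletionModels
import Literature.AnabelianGeometry.SemiGraphs.ProSigmaCompletionRestrict
import Literature.GroupTheory.CombinatorialGroupTheory.PuncturedSurfaceGroupCuspBases
import Mathlib.GroupTheory.SemidirectProduct
import Mathlib.Data.ZMod.QuotientGroup
import HarnessLib

/-!
# A MODEL of the index-two-inversion hypotheses: the pro-`Σ` completion of
# `π₁^{top}((E ∖ O)/±1) = Γ_{1,1} ⋊ ℤ/2` — non-vacuity of [AbsTopI] Prop 2.3 (i) at the quotient orbicurve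

S. Mochizuki, *Topics in Absolute Anabelian Geometry I: Generalities*, J. Math. Sci. Univ. Tokyo 19
(2012) [MochizukiAbsTopI2012], Prop. 2.3 (i) p. 19 ("… `X` is a hyperbolic orbicurve … Then `Δ` is
slim and elastic"); [IUTchI] Def. 3.1 (b): `C_F := X_F // {±1}`, `X_F = E_F ∖ {O}` a once-punctured
elliptic curve.  Companion of `ProfiniteIndexTwoInversionSlim.lean` (abc-iut-f-051 gen 3, p437009),
which proves slimness / elasticity / absence of finite normal subgroups for

  `Δ` profinite ⊇ `N` OPEN of index `2`, `ι : Γ_{g,r} → N` a pro-`Σ` completion of a hyperbolic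
  surface group, every `z ∈ Δ ∖ N` acting on `N^{ab}` by inversion (`z x z⁻¹ x ∈ closure [N, N]`).

This PROOF-ONLY file shows that these four hypotheses are JOINTLY SATISFIABLE, by the very object of
[IUTchI] Def. 3.1 (b): the topological fundamental group of the orbicurve `(E ∖ O)/±1` is
`Γ_{1,1} ⋊ ℤ/2` with `ℤ/2` acting on the free group `Γ_{1,1} = ⟨a, b⟩` by the elliptic involution
`a ↦ a⁻¹, b ↦ b⁻¹` (which is `−1` on `H₁`), and for every set of primes `Σ ∋ 2` its pro-`Σ`
completion `Δ` (abc-iut's `IsProSigmaCompletion.exists_isProSigmaCompletion`), with `N` the open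
subgroup cut out by `Γ_{1,1}` (`comap_surj`, `restrict_comp_of_range_eq`), satisfies them:

* `FreeGroup.exists_mulAut_inversion` — a free group on a nonempty set has an automorphism `τ` of
  order `2` with `τ(x)·x ∈ [F, F]` (inversion of the free generators);
* `PuncturedSurfaceGroup.exists_mulAut_inversion_one_one` — the same for `Γ_{1,1}` (free on `a, b`,
  abc-iut-L5-t9 / `exists_mulEquiv_freeGroup_elim_first`);
* `exists_indexTwoInv_model` — for `2 ∈ Σ`: a profinite `Δ`, an open `N ⊆ Δ` of index `2`, a pro-`Σ`
  completion `ι : Γ_{1,1} → N`, and the inversion property (on the dense image of `Γ × Γ` it is the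
  identity `t γ' γ γ'⁻¹ t⁻¹ γ = τ(γ'γγ'⁻¹)·γ ∈ [Γ, Γ]` in `Γ ⋊ ⟨τ⟩`; then by continuity, `closure [N, N]`
  being closed);
* `exists_indexTwoInv_model_slim_and_elastic` — hence (p437009) such a `Δ` is slim and elastic: the
  hypotheses of `slim_and_elastic_of_indexTwoInv` / `forall_finite_normal_eq_bot_of_indexTwoInv` are
  consistent and realised by `Δ_{C}` for `C = (E ∖ O)/±1`.

Plain (pro)finite group theory; no definition, no named fact; nothing here bears on [IUTchIII]
Cor. 3.12 or takes a side; typed ≠ proved elsewhere.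
-/

noncomputable section

open Topology

namespace Literature.GroupTheory.CombinatorialGroupTheory

/-- **Inversion of the free generators**: a free group on a nonempty set `β` has an automorphism `τ`
(`x_b ↦ x_b⁻¹`) with `τ² = 1`, `τ ≠ 1`, acting as `−1` on the abelianization: `τ(x)·x ∈ [F, F]` for
all `x` (the elliptic / hyperelliptic involution on `H₁`). [cite: MochizukiAbsTopI2012, Prop 2.3 (i) p.19] -/
theorem FreeGroup.exists_mulAut_inversion (β : Type*) [Nonempty β] :
    ∃ τ : MulAut (FreeGroup β), τ * τ = 1 ∧ τ ≠ 1 ∧ ∀ x, τ x * x ∈ commutator (FreeGroup β) := by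
  classical
  let f : FreeGroup β →* FreeGroup β := FreeGroup.lift fun b => (FreeGroup.of b)⁻¹
  have hfb : ∀ b, f (FreeGroup.of b) = (FreeGroup.of b)⁻¹ := fun b => by simp [f]
  have hff : f.comp f = MonoidHom.id _ := by
    refine FreeGroup.ext_hom _ _ fun b => ?_
    rw [MonoidHom.comp_apply, hfb, map_inv, hfb, inv_inv, MonoidHom.id_apply]
  have hffx : ∀ x, f (f x) = x := fun x => DFunLike.congr_fun hff x
  let τ : MulAut (FreeGroup β) :=
    { toFun := f, invFun := f, left_inv := hffx, right_inv := hffx, map_mul' := map_mul f }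
  have hτ : ∀ x, τ x = f x := fun _ => rfl
  refine ⟨τ, ?_, ?_, ?_⟩
  · ext x
    rw [MulAut.mul_apply, MulAut.one_apply, hτ, hτ, hffx]
  · obtain ⟨b⟩ := ‹Nonempty β›
    intro h
    have h1 : f (FreeGroup.of b) = FreeGroup.of b := by rw [← hτ, h, MulAut.one_apply]
    rw [hfb] at h1
    -- the character `x_b ↦ 1 ∈ ℤ` separates `x_b⁻¹` from `x_b`
    let χ : FreeGroup β →* Multiplicative ℤ := FreeGroup.lift fun _ => Multiplicative.ofAdd 1
    have h2 := congrArg χ h1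
    rw [map_inv] at h2
    have h3 : χ (FreeGroup.of b) = Multiplicative.ofAdd 1 := by simp [χ]
    rw [h3] at h2
    exact absurd (congrArg Multiplicative.toAdd h2) (by decide)
  · intro x
    have key : (Abelianization.of.comp f : FreeGroup β →* Abelianization (FreeGroup β)) =
        invMonoidHom.comp Abelianization.of := by
      refine FreeGroup.ext_hom _ _ fun b => ?_
      rw [MonoidHom.comp_apply, hfb, map_inv, MonoidHom.comp_apply, invMonoidHom_apply]
    have hx : Abelianization.of (f x) = (Abelianization.of x)⁻¹ := DFunLike.congr_fun key x
    rw [← Abelianization.ker_of, MonoidHom.mem_ker, map_mul, hτ, hx, inv_mul_cancel]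

/-- An isomorphism maps the commutator subgroup into the commutator subgroup. [folklore] -/
private theorem mulEquiv_mem_commutator {A B : Type*} [Group A] [Group B] (e : A ≃* B) {y : A}
    (hy : y ∈ commutator A) : e y ∈ commutator B := by
  have h : (commutator A).map e.toMonoidHom = commutator B := by
    rw [commutator_def, commutator_def, Subgroup.map_commutator, ← MonoidHom.range_eq_map,
      MonoidHom.range_eq_top.mpr e.surjective]
  have hy' := Subgroup.mem_map_of_mem e.toMonoidHom hy
  rwa [h] at hy'

/-- **The elliptic involution of `Γ_{1,1}`**: the once-punctured-torus group `Γ_{1,1}` (free on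
`a, b`) has an automorphism `τ` with `τ² = 1`, `τ ≠ 1` and `τ(x)·x ∈ [Γ, Γ]` for all `x` — the
action of `P ↦ −P` on `π₁(E ∖ O)`, `−1` on `H₁`. [cite: MochizukiAbsTopI2012, Prop 2.3 (i) p.19] -/
theorem PuncturedSurfaceGroup.exists_mulAut_inversion_one_one :
    ∃ τ : MulAut (PuncturedSurfaceGroup 1 1), τ * τ = 1 ∧ τ ≠ 1 ∧
      ∀ x, τ x * x ∈ commutator (PuncturedSurfaceGroup 1 1) := by
  obtain ⟨e, -, -, -⟩ := PuncturedSurfaceGroup.exists_mulEquiv_freeGroup_elim_first 1 0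
  haveI : Nonempty ((Fin 1 × Bool) ⊕ Fin 0) := ⟨Sum.inl (0, false)⟩
  obtain ⟨τ, hτ2, hτne, hτinv⟩ := FreeGroup.exists_mulAut_inversion ((Fin 1 × Bool) ⊕ Fin 0)
  let σ : MulAut (PuncturedSurfaceGroup 1 1) := (e.trans τ).trans e.symm
  have hσ : ∀ x, σ x = e.symm (τ (e x)) := fun _ => rfl
  refine ⟨σ, ?_, ?_, ?_⟩
  · ext x
    rw [MulAut.mul_apply, MulAut.one_apply, hσ, hσ, e.apply_symm_apply, ← MulAut.mul_apply, hτ2,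
      MulAut.one_apply, e.symm_apply_apply]
  · intro h
    apply hτne
    ext y
    have h1 : σ (e.symm y) = e.symm y := by rw [h, MulAut.one_apply]
    rw [hσ, e.apply_symm_apply] at h1
    simpa using congrArg e h1
  · intro x
    rw [hσ]
    have h1 : e.symm (τ (e x)) * x = e.symm (τ (e x) * e x) := by
      rw [map_mul, e.symm_apply_apply]
    rw [h1]
    exact mulEquiv_mem_commutator e.symm (hτinv (e x))

end Literature.GroupTheory.CombinatorialGroupTheory

namespace Literature.AnabelianGeometry.AbsoluteAnabelian

open Literature.AlgebraicGeometry.Frobenioids (IsSlimGroup)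
open Literature.AnabelianGeometry.Anabelioids
open Literature.AnabelianGeometry.SemiGraphs.SemiGraphOfAnabelioids
open Literature.GroupTheory.CombinatorialGroupTheory

open scoped commutatorElement in
/-- **A model of the index-two-inversion hypotheses** (non-vacuity of
`slim_and_elastic_of_indexTwoInv`): for every set `Σ` containing `2`, there are a profinite group
`Δ`, an OPEN subgroup `N ⊆ Δ` of index `2`, and a pro-`Σ` completion `ι : Γ_{1,1} → N` such that
every `z ∈ Δ ∖ N` acts on `N^{ab}` by inversion — namely `Δ` = the pro-`Σ` completion of
`π₁^{top}((E ∖ O)/±1) = Γ_{1,1} ⋊ ⟨τ⟩`, `τ` the elliptic involution, and `N` the closure of `Γ_{1,1}`.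
[cite: MochizukiAbsTopI2012, Prop 2.3 (i) p.19] -/
theorem exists_indexTwoInv_model (Sigma : Set ℕ) (h2 : 2 ∈ Sigma) :
    ∃ (Δ : ProfiniteGrp.{0}) (N : Subgroup Δ) (ι : PuncturedSurfaceGroup 1 1 →* N),
      IsOpen (N : Set Δ) ∧ N.index = 2 ∧ IsProSigmaCompletion Sigma ι ∧
      ∀ z : Δ, z ∉ N → ∀ x ∈ N, z * x * z⁻¹ * x ∈ (⁅N, N⁆ : Subgroup Δ).topologicalClosure := by
  classical
  obtain ⟨τ, hτ2, hτne, hτinv⟩ := PuncturedSurfaceGroup.exists_mulAut_inversion_one_one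
  -- the order-2 group `Z = ⟨τ⟩ ⊆ Aut Γ` and the semidirect product `Γ ⋊ Z`, `Γ = Γ_{1,1}`
  let Z : Subgroup (MulAut (PuncturedSurfaceGroup 1 1)) := Subgroup.zpowers τ
  have hZ : Nat.card Z = 2 := by
    rw [Nat.card_zpowers]
    exact orderOf_eq_prime (by rw [pow_two]; exact hτ2) hτne
  let t : Z := ⟨τ, Subgroup.mem_zpowers τ⟩
  obtain ⟨Δ, ι₀, hι₀⟩ :=
    IsProSigmaCompletion.exists_isProSigmaCompletion ((PuncturedSurfaceGroup 1 1) ⋊[Z.subtype] Z) Sigma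
  have hRn : (SemidirectProduct.inl : (PuncturedSurfaceGroup 1 1) →* (PuncturedSurfaceGroup 1 1) ⋊[Z.subtype] Z).range.Normal := by
    rw [SemidirectProduct.range_inl_eq_ker_rightHom]
    infer_instance
  have hRi : (SemidirectProduct.inl : (PuncturedSurfaceGroup 1 1) →* (PuncturedSurfaceGroup 1 1) ⋊[Z.subtype] Z).range.index = 2 := by
    rw [SemidirectProduct.range_inl_eq_ker_rightHom, Subgroup.index_ker,
      MonoidHom.range_eq_top.mpr SemidirectProduct.rightHom_surjective, Subgroup.card_top, hZ]
  have hR2 : IsSigmaInteger Sigma (SemidirectProduct.inl : (PuncturedSurfaceGroup 1 1) →* (PuncturedSurfaceGroup 1 1) ⋊[Z.subtype] Z).range.index := by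
    rw [hRi]
    exact ⟨two_pos, fun p hp hp2 => by
      rwa [(Nat.prime_dvd_prime_iff_eq hp Nat.prime_two).mp hp2]⟩
  obtain ⟨N, hNo, hNc⟩ := hι₀.comap_surj _ hRn hR2
  haveI : N.Normal :=
    IsProSigmaCompletion.normal_of_comap_normal hι₀ N hNo (by rw [hNc]; exact hRn)
  have hN2 : N.index = 2 := by
    rw [← IsProSigmaCompletion.index_comap_of_normal hι₀ N hNo, hNc, hRi]
  have hmem : ∀ x : (PuncturedSurfaceGroup 1 1), ι₀ (SemidirectProduct.inl x) ∈ N := fun x => by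
    have hx : SemidirectProduct.inl x ∈ N.comap ι₀ := by
      rw [hNc]
      exact ⟨x, rfl⟩
    exact hx
  let ι : (PuncturedSurfaceGroup 1 1) →* N := (ι₀.comp SemidirectProduct.inl).codRestrict N hmem
  have hι : IsProSigmaCompletion Sigma ι :=
    IsProSigmaCompletion.restrict_comp_of_range_eq hι₀ N hNo SemidirectProduct.inl
      SemidirectProduct.inl_injective hNc.symm hmem
  refine ⟨Δ, N, ι, hNo, hN2, hι, fun z hzN x hxN => ?_⟩
  -- the generator of `Δ/N`
  let z₀ : Δ := ι₀ (SemidirectProduct.inr t)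
  have hz₀ : z₀ ∉ N := by
    intro h
    have h' : (SemidirectProduct.inr t : (PuncturedSurfaceGroup 1 1) ⋊[Z.subtype] Z) ∈ N.comap ι₀ := h
    rw [hNc, SemidirectProduct.range_inl_eq_ker_rightHom, MonoidHom.mem_ker,
      SemidirectProduct.rightHom_inr] at h'
    exact hτne (congrArg Subtype.val h')
  -- the inversion identity as a closed condition on `N × N`
  let D : Subgroup Δ := (⁅N, N⁆ : Subgroup Δ).topologicalClosure
  let Φ : N × N → Δ := fun p => z₀ * (p.1 : Δ) * (p.2 : Δ) * (z₀ * (p.1 : Δ))⁻¹ * (p.2 : Δ)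
  have hΦc : Continuous Φ :=
    ((((continuous_const.mul (continuous_subtype_val.comp continuous_fst)).mul
      (continuous_subtype_val.comp continuous_snd)).mul
      ((continuous_const.mul (continuous_subtype_val.comp continuous_fst)).inv)).mul
      (continuous_subtype_val.comp continuous_snd))
  have hT : IsClosed (Φ ⁻¹' (D : Set Δ)) := (Subgroup.isClosed_topologicalClosure _).preimage hΦc
  -- it holds on the dense image of `Γ × Γ`
  have hrange : (ι₀.comp SemidirectProduct.inl).range ≤ N := by
    rintro _ ⟨y, rfl⟩
    exact hmem y
  have hcomm : (commutator (PuncturedSurfaceGroup 1 1)).map (ι₀.comp SemidirectProduct.inl) ≤ ⁅N, N⁆ := by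
    rw [commutator_def, Subgroup.map_commutator, ← MonoidHom.range_eq_map]
    exact Subgroup.commutator_mono hrange hrange
  have hsub : Set.range (Prod.map ι ι) ⊆ Φ ⁻¹' (D : Set Δ) := by
    rintro _ ⟨⟨γ', γ⟩, rfl⟩
    rw [Set.mem_preimage]
    -- `Φ (ι γ', ι γ) = ι₀ (t γ' γ (t γ')⁻¹ γ) = ι₀ (τ(γ'γγ'⁻¹) γ)`
    have hL : Φ (Prod.map ι ι (γ', γ)) =
        ι₀ (SemidirectProduct.inr t * SemidirectProduct.inl γ' * SemidirectProduct.inl γ *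
          (SemidirectProduct.inr t * SemidirectProduct.inl γ')⁻¹ * SemidirectProduct.inl γ) := by
      simp only [Φ, z₀, Prod.map_apply, map_mul, map_inv]
      rfl
    have hR : SemidirectProduct.inr t * SemidirectProduct.inl γ' * SemidirectProduct.inl γ *
          (SemidirectProduct.inr t * SemidirectProduct.inl γ')⁻¹ * SemidirectProduct.inl γ =
        (SemidirectProduct.inl ((Z.subtype t) (γ' * γ * γ'⁻¹) * γ) : (PuncturedSurfaceGroup 1 1) ⋊[Z.subtype] Z) := by
      rw [map_mul SemidirectProduct.inl, SemidirectProduct.inl_aut, map_mul, map_mul, map_inv,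
        map_inv]
      group
    have hw : (Z.subtype t) (γ' * γ * γ'⁻¹) * γ ∈ commutator (PuncturedSurfaceGroup 1 1) := by
      have h1 := hτinv (γ' * γ * γ'⁻¹)
      have h2 : ⁅γ', γ⁻¹⁆ ∈ commutator (PuncturedSurfaceGroup 1 1) :=
        Subgroup.commutator_mem_commutator (Subgroup.mem_top γ') (Subgroup.mem_top γ⁻¹)
      have h3 := (commutator (PuncturedSurfaceGroup 1 1)).mul_mem h1 h2
      have h4 : τ (γ' * γ * γ'⁻¹) * (γ' * γ * γ'⁻¹) * ⁅γ', γ⁻¹⁆ = τ (γ' * γ * γ'⁻¹) * γ := by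
        rw [commutatorElement_def]
        group
      rw [h4] at h3
      exact h3
    rw [hL, hR]
    exact Subgroup.le_topologicalClosure _ (hcomm (Subgroup.mem_map_of_mem _ hw))
  -- hence everywhere, by density and closedness
  have hd : DenseRange (Prod.map ι ι) := DenseRange.prodMap hι.dense hι.dense
  have hall : ∀ p : N × N, Φ p ∈ (D : Set Δ) := by
    have hcl : closure (Set.range (Prod.map ι ι)) ⊆ Φ ⁻¹' (D : Set Δ) :=
      hT.closure_subset_iff.mpr hsub
    rw [hd.closure_range] at hcl
    exact fun p => hcl (Set.mem_univ p)
  -- apply to `(z₀⁻¹ z, x)`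
  have hu : z₀⁻¹ * z ∈ N := by
    rw [Subgroup.mul_mem_iff_of_index_two hN2]
    exact iff_of_false (fun h => hz₀ (N.inv_mem_iff.mp h)) hzN
  have key := hall (⟨z₀⁻¹ * z, hu⟩, ⟨x, hxN⟩)
  change z₀ * (z₀⁻¹ * z) * x * (z₀ * (z₀⁻¹ * z))⁻¹ * x ∈ (D : Set Δ) at key
  rwa [mul_inv_cancel_left] at key

/-- **Joint satisfiability of the index-two model**: for every set of primes `Σ ∋ 2` there are a
profinite `Δ`, an open index-2 subgroup `N` with a pro-`Σ` completion `ι : Γ_{1,1} → N` and the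
inversion property, and (by `slim_and_elastic_of_indexTwoInv`, p437009) this `Δ` is SLIM and
ELASTIC — [AbsTopI] Prop 2.3 (i) for the quotient orbicurve `(E ∖ O)/±1` realised at its own
fundamental group. [cite: MochizukiAbsTopI2012, Prop 2.3 (i) p.19] -/
theorem exists_indexTwoInv_model_slim_and_elastic (Sigma : Set ℕ) (h2 : 2 ∈ Sigma)
    (hSp : ∀ p ∈ Sigma, p.Prime) :
    ∃ (Δ : ProfiniteGrp.{0}) (N : Subgroup Δ) (ι : PuncturedSurfaceGroup 1 1 →* N),
      IsOpen (N : Set Δ) ∧ N.index = 2 ∧ IsProSigmaCompletion Sigma ι ∧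
      (∀ z : Δ, z ∉ N → ∀ x ∈ N, z * x * z⁻¹ * x ∈ (⁅N, N⁆ : Subgroup Δ).topologicalClosure) ∧
      (∀ F : Subgroup Δ, F.Normal → (F : Set Δ).Finite → F = ⊥) ∧ IsSlimGroup Δ ∧ IsElastic Δ := by
  obtain ⟨Δ, N, ι, hNo, hN2, hι, hinv⟩ := exists_indexTwoInv_model Sigma h2
  have hgr : PuncturedSurfaceGroup.IsHyperbolicType 1 1 := by
    unfold PuncturedSurfaceGroup.IsHyperbolicType
    norm_num
  have hse := slim_and_elastic_of_indexTwoInv N hNo hN2 ⟨2, h2⟩ hSp hgr ι hι hinv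
  exact ⟨Δ, N, ι, hNo, hN2, hι, hinv,
    forall_finite_normal_eq_bot_of_indexTwoInv N hNo hN2 ⟨2, h2⟩ hSp hgr ι hι hinv, hse.1, hse.2⟩

/-- In particular at `Σ = {all primes}` (the profinite completion, characteristic `0`): a slim and
elastic profinite `Δ` with an open index-2 pro-finite free subgroup of rank `2` under inversion
exists. [cite: MochizukiAbsTopI2012, Prop 2.3 (i) p.19] -/
theorem exists_indexTwoInv_model_slim_and_elastic_primes :
    ∃ (Δ : ProfiniteGrp.{0}) (N : Subgroup Δ) (ι : PuncturedSurfaceGroup 1 1 →* N),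
      IsOpen (N : Set Δ) ∧ N.index = 2 ∧ IsProSigmaCompletion {p : ℕ | p.Prime} ι ∧
      (∀ z : Δ, z ∉ N → ∀ x ∈ N, z * x * z⁻¹ * x ∈ (⁅N, N⁆ : Subgroup Δ).topologicalClosure) ∧
      (∀ F : Subgroup Δ, F.Normal → (F : Set Δ).Finite → F = ⊥) ∧ IsSlimGroup Δ ∧ IsElastic Δ :=
  exists_indexTwoInv_model_slim_and_elastic _ Nat.prime_two fun _ hp => hp

end Literature.AnabelianGeometry.AbsoluteAnabelian

end
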